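/-
Copyright (c) 2026 the pub-hodgecm-mathlib formalisation cell (harness21).  Prover seat hodgecm-mathlib-LH5-p05 (g12), 2026-09-03.  E1 row 55 file A-III «`U(σ,J₀)`-ORBITS ON
THE TREE VIA THE APARTMENT» (offer 03:4xZ to keeper F0P3a-p03 (g30); generic half of the 57-B orbit letters `xv idx₀ tr₀ ∕ xe tr₁` of F0P3-p02 (g27)).
-/
import Literature.NumberTheory.Automorphic.UnitaryLatticeTreeHorosphereTransversal   -- A-II (this seat): (H5) `exists_mem_unipotentU_latticeGraphIso_apartmentEnum_eq`, (H7s) `exists_mem_unipotentU_sym2Map_apartmentEnum_eq_of_adj`; brings A-I ((T) `exists_mem_torusU_latticeGraphIso_apartmentEnum_eq_add`) and ★ 39γ (`mapGL_weylLongU_apartmentEnum`)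
import HarnessLib

/-!
# The lattice tree of the unramified `U(3)`: THE `U(σ, J₀)`-ORBITS VIA THE APARTMENT — two vertex orbits (`U · A 0`, `U · A 1`), ONE edge orbit (`U · {A 0, A 1}`)
# (Bruhat–Tits 1972 §10, (4.4.4); Serre, *Trees* II.1.1)

Topic `NumberTheory/Automorphic`; namespace `Literature.NumberTheory.Automorphic.UnitaryLatticeTree`.  THEOREMS ONLY (no definition, no instance, no notation, no named
fact, no `sorry`).  Cell `pub/hodgecm-mathlib` (D-0151), crux H413 = `stmt-HodgeConjecture-24833`; E1 row 55 file A-III: the ORBIT DATA of the whole group `U = U(σ, J₀)` on the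
vertices and edges of its tree, read off the standard apartment `A` (★ 39γ, hypothesis-style `(A) (hA0) (hA1)`) through A-II's horosphere transversal (every vertex ∕ edge is an
`N`-translate of an apartment vertex ∕ edge) and A-I's torus translations `t_c · A j = A (j + 2c)`, plus the long Weyl element `w₀ · A j = A (−j)` (★ 39γ).  Consumers: the
block-permutation ∕ compact-induction reading of the Schneider–Stuhler chain modules (★ `BlockPermutationCompactInduction`, `SchneiderStuhlerChainsCompactInduction`: letters
`xv idx₀ tr₀ hidx₀ hidx₀a htr₀` ∕ `xe idx₁ tr₁ …`), via the datum file B of row 55.  HONEST LABEL: count-neutral lattice-model base layer; HC_CM is proved only modulo the 2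
remaining named inputs (hLiu418 24832, h413 24833) until rung 0 closes; nothing printed is asserted here.

THE MATHEMATICS.  Vertex TRANSITIVITY PER TYPE is ★ (39γ §2: every self-dual vertex is `u · A 0`, every type-two vertex is `v · A (−1)`; ★ frames ∕ type-two transitivity) and is
not restated; what is packaged here is the parity-free form `x ∈ U · A 0 ∪ U · A 1` (from (H5): `x = n · A j`, `j = 2c` or `2c + 1`, and `A (2c + i) = t_c · A i`), its
EXCLUSIVITY (`A 0` has type `0`, `A 1` has type `2`, types are `U`-invariant and unique: ★ `isVertexLattice_mapGL_iff`, ★ `type_unique`), and the new statement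
**`U` IS TRANSITIVE ON THE EDGES**: `{x, y} = n · {A j, A (j+1)}` (A-II (H7)); for `j = 2c` this is `n t_c · {A 0, A 1}`, for `j = 2c + 1` it is `n t_{c+1} w₀ · {A 0, A 1}`
(`w₀ · A 0 = A 0`, `w₀ · A 1 = A (−1)`, `t_{c+1} · A (−1) = A (2c + 1)`).  [BruhatTits1972] §10 ∕ (4.4.4) («`K₀` est transitif sur les chambres contenant son sommet» — with
vertex transitivity per type this is edge transitivity of the whole group on each type of oriented edge); [Serre1980Trees] II.1.1 (the tree of `SL₂`; here the quasi-split
`U(3)` analogue, whose tree is bi-regular with two vertex types and one edge type).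

WHAT IS FORMALISED (common binders ★ 39γ `section Enum` verbatim: `(hd) (A) (hA0) (hA1)`).
* §1 `latticeGraphIso_weylLongU_apartmentEnum` (`w₀ · A j = A (−j)`, vertex form of ★ `mapGL_weylLongU_apartmentEnum`), `isSelfDualLattice_apartmentEnum_zero`,
  `isVertexLattice_two_apartmentEnum_one` (the types of `A 0`, `A 1`).
* §2 vertices: `exists_latticeGraphIso_apartmentEnum_zero_eq_or_one_eq` (`∃ u, u · A 0 = x ∨ u · A 1 = x`), `not_exists_latticeGraphIso_apartmentEnum_one_eq_zero`
  (`u · A 1 ≠ A 0`), `not_exists_latticeGraphIso_apartmentEnum_zero_eq_and_one_eq` (exclusivity).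
* §3 edges: **`exists_latticeGraphIso_sym2Map_apartmentEnum_zero_one_eq_of_adj`** (`∃ u, u · s(A 0, A 1) = s(x, y)`), the oriented-or form
  `exists_latticeGraphIso_apartmentEnum_zero_one_eq_of_adj`, the `edgeSet` form `exists_latticeGraphIso_mapEdgeSet_apartmentEnum_zero_one_eq`.
* §4 packages in the consumers' letters: `exists_vertexOrbitData` (`idx₀ : Vtx → Fin 2`, `tr₀ : Vtx → U` with `hidx₀ ∕ hidx₀a ∕ htr₀` for `xv := ![A 0, A 1]`),
  `exists_edgeOrbitData` (`tr₁ : edgeSet → U` with `tr₁ e · {A 0, A 1} = e`; one orbit, `idx₁` constant).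

## References
* [BruhatTits1972] F. Bruhat, J. Tits, *Groupes réductifs sur un corps local I*, Publ. Math. IHÉS 41 (1972), §10, (4.4.4).
* [Serre1980Trees] J.-P. Serre, *Trees* (1980), Ch. II §1.1.
-/

set_option autoImplicit false

noncomputable section

open scoped Valued WithZero Matrix MatrixGroups

namespace Literature.NumberTheory.Automorphic.UnitaryLatticeTree

open _root_.SimpleGraph Literature.NumberTheory.Automorphic Literature.NumberTheory.Automorphic.HermitianLattice
open Literature.NumberTheory.Automorphic.UnitaryGroup
open Literature.NumberTheory.Automorphic.CartanUnique (uniformizer_ne_zero)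

variable {K : Type*} [Field K] [Valued K ℤᵐ⁰] {σ : K →+* K} {ϖ : K}

section Enum

variable (hd : UnramifiedLocalConjDatum σ ϖ)
  (A : ℤ → {M : Submodule 𝒪[K] (Fin 3 → K) // IsVertex σ ϖ ((StdForm.antidiagonal 3).over K) M})
  (hA0 : ∀ a : ℤ, (A (2 * a)).1 = latt (Matrix.diagonal ![ϖ ^ a, (1 : K), ϖ ^ (-a)]))
  (hA1 : ∀ a : ℤ, (A (2 * a + 1)).1 = latt (Matrix.diagonal ![ϖ ^ (a + 1), (1 : K), ϖ ^ (-a)]))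
include hd hA0 hA1

/-! ## §1 The long Weyl element on the apartment; the types of `A 0` and `A 1` -/

omit hd in
/-- **`w₀ · A j = A (−j)`**, vertex form (★ `mapGL_weylLongU_apartmentEnum`). [cite: BruhatTits1972, §10] -/
theorem latticeGraphIso_weylLongU_apartmentEnum (j : ℤ) :
    latticeGraphIso σ ϖ ((StdForm.antidiagonal 3).over K)
        (weylLongU σ (rfl : (StdForm.antidiagonal 3).over K = (StdForm.antidiagonal 3).over K)) (A j) = A (-j) :=
  Subtype.ext (by rw [latticeGraphIso_apply_val]; exact mapGL_weylLongU_apartmentEnum A hA0 hA1 j)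

omit hA1 in
/-- `A 0 = L₀` is self-dual (type `0`). [cite: BruhatTits1972, §10] -/
theorem isSelfDualLattice_apartmentEnum_zero : IsSelfDualLattice σ ϖ ((StdForm.antidiagonal 3).over K) (A 0).1 := by
  have h := hA0 0
  rw [mul_zero] at h
  rw [h]
  exact isSelfDualLattice_latt_diagonal_zpow hd.σσ hd.σϖ (v_le_one_of_v_eq_exp_neg_one hd.vϖ) (uniformizer_ne_zero hd.vϖ) 0

omit hA0 in
/-- `A 1 = L′₁` has type `2`. [cite: BruhatTits1972, §10] -/
theorem isVertexLattice_two_apartmentEnum_one : IsVertexLattice σ ϖ ((StdForm.antidiagonal 3).over K) 2 (A 1).1 := by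
  have h := hA1 0
  rw [show (2 * 0 + 1 : ℤ) = 1 by ring] at h
  rw [h]
  convert isVertexLattice_two_latt_diagonal_zpow hd.σσ hd.σϖ (v_le_one_of_v_eq_exp_neg_one hd.vϖ) (uniformizer_ne_zero hd.vϖ) 1 using 4 <;> simp

/-! ## §2 Vertices: `X = U · A 0 ⊔ U · A 1` -/

/-- **EVERY VERTEX IS `u · A 0` OR `u · A 1`** for some `u ∈ U(σ, J₀)` ((H5): `x = n · A j`; `A (2c) = t_c · A 0`, `A (2c + 1) = t_c · A 1` by (T)).
[cite: BruhatTits1972, §10] [cite: Serre1980Trees, II.1.1] -/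
theorem exists_latticeGraphIso_apartmentEnum_zero_eq_or_one_eq (x : {M : Submodule 𝒪[K] (Fin 3 → K) // IsVertex σ ϖ ((StdForm.antidiagonal 3).over K) M}) :
    ∃ u : unitaryGroupOfForm σ ((StdForm.antidiagonal 3).over K),
      latticeGraphIso σ ϖ ((StdForm.antidiagonal 3).over K) u (A 0) = x ∨ latticeGraphIso σ ϖ ((StdForm.antidiagonal 3).over K) u (A 1) = x := by
  obtain ⟨n, -, j, hj⟩ := exists_mem_unipotentU_latticeGraphIso_apartmentEnum_eq hd A hA0 hA1 x
  obtain ⟨c, rfl | rfl⟩ := Int.even_or_odd' j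
  · obtain ⟨t, -, -, htA⟩ := exists_mem_torusU_latticeGraphIso_apartmentEnum_eq_add hd A hA0 hA1 c
    refine ⟨n * t, Or.inl ?_⟩
    rw [latticeGraphIso_mul_apply, htA, zero_add]
    exact hj
  · obtain ⟨t, -, -, htA⟩ := exists_mem_torusU_latticeGraphIso_apartmentEnum_eq_add hd A hA0 hA1 c
    refine ⟨n * t, Or.inr ?_⟩
    rw [latticeGraphIso_mul_apply, htA, add_comm]
    exact hj

/-- **NO `u ∈ U` MAPS `A 1` TO `A 0`** (types `2 ≠ 0` are `U`-invariant and unique: ★ `isVertexLattice_mapGL_iff`, ★ `type_unique`). [cite: BruhatTits1972, §10] -/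
theorem not_exists_latticeGraphIso_apartmentEnum_one_eq_zero :
    ¬ ∃ u : unitaryGroupOfForm σ ((StdForm.antidiagonal 3).over K), latticeGraphIso σ ϖ ((StdForm.antidiagonal 3).over K) u (A 1) = A 0 := by
  rintro ⟨u, hu⟩
  have h2 : IsVertexLattice σ ϖ ((StdForm.antidiagonal 3).over K) 2 (A 0).1 := by
    rw [← hu, latticeGraphIso_apply_val, isVertexLattice_mapGL_iff]
    exact isVertexLattice_two_apartmentEnum_one hd A hA1
  have := type_unique hd.vσ hd.vϖ (isSelfDualLattice_apartmentEnum_zero hd A hA0) h2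
  omega

/-- **EXCLUSIVITY**: a vertex is not both `u · A 0` and `u′ · A 1`. [cite: BruhatTits1972, §10] -/
theorem not_exists_latticeGraphIso_apartmentEnum_zero_eq_and_one_eq (x : {M : Submodule 𝒪[K] (Fin 3 → K) // IsVertex σ ϖ ((StdForm.antidiagonal 3).over K) M}) :
    ¬ ((∃ u : unitaryGroupOfForm σ ((StdForm.antidiagonal 3).over K), latticeGraphIso σ ϖ ((StdForm.antidiagonal 3).over K) u (A 0) = x) ∧
       ∃ u' : unitaryGroupOfForm σ ((StdForm.antidiagonal 3).over K), latticeGraphIso σ ϖ ((StdForm.antidiagonal 3).over K) u' (A 1) = x) := by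
  rintro ⟨⟨u, hu⟩, ⟨u', hu'⟩⟩
  refine not_exists_latticeGraphIso_apartmentEnum_one_eq_zero hd A hA0 hA1 ⟨u⁻¹ * u', ?_⟩
  rw [latticeGraphIso_mul_apply, hu', ← hu, latticeGraphIso_inv_mul_apply]

/-! ## §3 Edges: `U` is transitive on the edges -/

/-- **`U(σ, J₀)` IS TRANSITIVE ON THE EDGES OF ITS TREE**: every edge `{x, y}` is `u · {A 0, A 1}` ((H7): `{x, y} = n · {A j, A (j+1)}`; `j = 2c`: `u = n t_c`; `j = 2c + 1`:
`u = n t_{c+1} w₀`, since `w₀ · A 0 = A 0`, `w₀ · A 1 = A (−1)` and `t_{c+1} · A (−1) = A (2c + 1)`). [cite: BruhatTits1972, §10, (4.4.4)] [cite: Serre1980Trees, II.1.1] -/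
theorem exists_latticeGraphIso_sym2Map_apartmentEnum_zero_one_eq_of_adj {x y : {M : Submodule 𝒪[K] (Fin 3 → K) // IsVertex σ ϖ ((StdForm.antidiagonal 3).over K) M}}
    (hxy : (latticeGraph σ ϖ ((StdForm.antidiagonal 3).over K)).Adj x y) :
    ∃ u : unitaryGroupOfForm σ ((StdForm.antidiagonal 3).over K), Sym2.map (latticeGraphIso σ ϖ ((StdForm.antidiagonal 3).over K) u) s(A 0, A 1) = s(x, y) := by
  obtain ⟨n, -, j, hj⟩ := exists_mem_unipotentU_sym2Map_apartmentEnum_eq_of_adj hd A hA0 hA1 hxy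
  rw [Sym2.map_mk] at hj
  obtain ⟨c, rfl | rfl⟩ := Int.even_or_odd' j
  · obtain ⟨t, -, -, htA⟩ := exists_mem_torusU_latticeGraphIso_apartmentEnum_eq_add hd A hA0 hA1 c
    refine ⟨n * t, ?_⟩
    rw [Sym2.map_mk, latticeGraphIso_mul_apply, latticeGraphIso_mul_apply, htA, htA, zero_add, add_comm 1 (2 * c)]
    exact hj
  · obtain ⟨t, -, -, htA⟩ := exists_mem_torusU_latticeGraphIso_apartmentEnum_eq_add hd A hA0 hA1 (c + 1)
    refine ⟨n * t * weylLongU σ (rfl : (StdForm.antidiagonal 3).over K = (StdForm.antidiagonal 3).over K), ?_⟩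
    rw [Sym2.map_mk, latticeGraphIso_mul_apply, latticeGraphIso_mul_apply, latticeGraphIso_mul_apply, latticeGraphIso_mul_apply,
      latticeGraphIso_weylLongU_apartmentEnum A hA0 hA1, latticeGraphIso_weylLongU_apartmentEnum A hA0 hA1, neg_zero, htA, htA,
      show (0 : ℤ) + 2 * (c + 1) = 2 * c + 1 + 1 by ring, show (-1 : ℤ) + 2 * (c + 1) = 2 * c + 1 by ring, Sym2.eq_swap]
    exact hj

/-- **Oriented-or form**: `(x, y) = (u·A 0, u·A 1)` or `(y, x) = (u·A 0, u·A 1)`. [cite: BruhatTits1972, §10, (4.4.4)] [cite: Serre1980Trees, II.1.1] -/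
theorem exists_latticeGraphIso_apartmentEnum_zero_one_eq_of_adj {x y : {M : Submodule 𝒪[K] (Fin 3 → K) // IsVertex σ ϖ ((StdForm.antidiagonal 3).over K) M}}
    (hxy : (latticeGraph σ ϖ ((StdForm.antidiagonal 3).over K)).Adj x y) :
    ∃ u : unitaryGroupOfForm σ ((StdForm.antidiagonal 3).over K),
      (latticeGraphIso σ ϖ ((StdForm.antidiagonal 3).over K) u (A 0) = x ∧ latticeGraphIso σ ϖ ((StdForm.antidiagonal 3).over K) u (A 1) = y) ∨
      (latticeGraphIso σ ϖ ((StdForm.antidiagonal 3).over K) u (A 0) = y ∧ latticeGraphIso σ ϖ ((StdForm.antidiagonal 3).over K) u (A 1) = x) := by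
  obtain ⟨u, hu⟩ := exists_latticeGraphIso_sym2Map_apartmentEnum_zero_one_eq_of_adj hd A hA0 hA1 hxy
  rw [Sym2.map_mk, Sym2.eq_iff] at hu
  exact ⟨u, hu⟩

/-- **`edgeSet` form** (the consumers' `act₁ g := (latticeGraphIso … g).mapEdgeSet`): every edge is the image of the standard edge `⟨s(A 0, A 1), _⟩`.
[cite: BruhatTits1972, §10, (4.4.4)] [cite: Serre1980Trees, II.1.1] -/
theorem exists_latticeGraphIso_mapEdgeSet_apartmentEnum_zero_one_eq (e : (latticeGraph σ ϖ ((StdForm.antidiagonal 3).over K)).edgeSet) :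
    ∃ u : unitaryGroupOfForm σ ((StdForm.antidiagonal 3).over K),
      (latticeGraphIso σ ϖ ((StdForm.antidiagonal 3).over K) u).mapEdgeSet
          ⟨s(A 0, A 1), (mem_edgeSet _).2 (by simpa using latticeGraph_adj_apartmentEnum_succ hd A hA0 hA1 0)⟩ = e := by
  obtain ⟨e, he⟩ := e
  induction e using Sym2.ind with
  | h x y =>
    obtain ⟨u, hu⟩ := exists_latticeGraphIso_sym2Map_apartmentEnum_zero_one_eq_of_adj hd A hA0 hA1 ((mem_edgeSet _).1 he)
    exact ⟨u, Subtype.ext hu⟩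

/-! ## §4 The orbit data packaged in the consumers' letters (`xv := ![A 0, A 1]`, one edge orbit) -/

/-- **VERTEX ORBIT DATA**: with representatives `xv := ![A 0, A 1] : Fin 2 → Vtx` there are an orbit index `idx₀ : Vtx → Fin 2` and transporters `tr₀ : Vtx → U` with
`idx₀ (xv i) = i`, `idx₀ (g · x) = idx₀ x` and `tr₀ x · xv (idx₀ x) = x` (the letters `hidx hidx_act htr` of ★ `BlockPermutationCompactInduction` for the vertex blocks).
[cite: BruhatTits1972, §10] [cite: Serre1980Trees, II.1.1] -/
theorem exists_vertexOrbitData :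
    ∃ (idx₀ : {M : Submodule 𝒪[K] (Fin 3 → K) // IsVertex σ ϖ ((StdForm.antidiagonal 3).over K) M} → Fin 2)
      (tr₀ : {M : Submodule 𝒪[K] (Fin 3 → K) // IsVertex σ ϖ ((StdForm.antidiagonal 3).over K) M} → unitaryGroupOfForm σ ((StdForm.antidiagonal 3).over K)),
      (∀ i : Fin 2, idx₀ (![A 0, A 1] i) = i) ∧
      (∀ (g : unitaryGroupOfForm σ ((StdForm.antidiagonal 3).over K)) (x : {M : Submodule 𝒪[K] (Fin 3 → K) // IsVertex σ ϖ ((StdForm.antidiagonal 3).over K) M}),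
          idx₀ (latticeGraphIso σ ϖ ((StdForm.antidiagonal 3).over K) g x) = idx₀ x) ∧
      ∀ x : {M : Submodule 𝒪[K] (Fin 3 → K) // IsVertex σ ϖ ((StdForm.antidiagonal 3).over K) M},
        latticeGraphIso σ ϖ ((StdForm.antidiagonal 3).over K) (tr₀ x) (![A 0, A 1] (idx₀ x)) = x := by
  classical
  -- the type-`0` predicate and its `U`-invariance
  let P : {M : Submodule 𝒪[K] (Fin 3 → K) // IsVertex σ ϖ ((StdForm.antidiagonal 3).over K) M} → Prop :=
    fun x => ∃ u : unitaryGroupOfForm σ ((StdForm.antidiagonal 3).over K), latticeGraphIso σ ϖ ((StdForm.antidiagonal 3).over K) u (A 0) = x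
  have hPinv : ∀ (g : unitaryGroupOfForm σ ((StdForm.antidiagonal 3).over K)) x, P (latticeGraphIso σ ϖ ((StdForm.antidiagonal 3).over K) g x) ↔ P x := by
    intro g x
    constructor
    · rintro ⟨u, hu⟩
      exact ⟨g⁻¹ * u, by rw [latticeGraphIso_mul_apply, hu, latticeGraphIso_inv_mul_apply]⟩
    · rintro ⟨u, hu⟩
      exact ⟨g * u, by rw [latticeGraphIso_mul_apply, hu]⟩
  have hP1 : ¬ P (A 1) := by
    rintro ⟨u, hu⟩
    exact not_exists_latticeGraphIso_apartmentEnum_one_eq_zero hd A hA0 hA1 ⟨u⁻¹, by rw [← hu, latticeGraphIso_inv_mul_apply]⟩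
  refine ⟨fun x => if P x then 0 else 1,
    fun x => if h : P x then h.choose else (exists_latticeGraphIso_apartmentEnum_zero_eq_or_one_eq hd A hA0 hA1 x).choose,
    fun i => ?_, fun g x => ?_, fun x => ?_⟩
  · fin_cases i
    · have h0 : P (A 0) := ⟨1, latticeGraphIso_one_apply _⟩
      simp [h0]
    · simp [hP1]
  · simp only [hPinv]
  · by_cases h : P x
    · simp only [h, ↓reduceIte, dif_pos]
      exact h.choose_spec
    · simp only [h, ↓reduceIte, dif_neg, not_false_eq_true]
      exact (exists_latticeGraphIso_apartmentEnum_zero_eq_or_one_eq hd A hA0 hA1 x).choose_spec.resolve_left (fun h0 => h ⟨_, h0⟩)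

/-- **EDGE ORBIT DATA**: one orbit — transporters `tr₁ : edgeSet → U` with `tr₁ e · {A 0, A 1} = e` (so `idx₁` is constant and `hidx₁ ∕ hidx₁a` are trivial at the consumer).
[cite: BruhatTits1972, §10, (4.4.4)] [cite: Serre1980Trees, II.1.1] -/
theorem exists_edgeOrbitData :
    ∃ tr₁ : (latticeGraph σ ϖ ((StdForm.antidiagonal 3).over K)).edgeSet → unitaryGroupOfForm σ ((StdForm.antidiagonal 3).over K),
      ∀ e, (latticeGraphIso σ ϖ ((StdForm.antidiagonal 3).over K) (tr₁ e)).mapEdgeSet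
          ⟨s(A 0, A 1), (mem_edgeSet _).2 (by simpa using latticeGraph_adj_apartmentEnum_succ hd A hA0 hA1 0)⟩ = e :=
  ⟨fun e => (exists_latticeGraphIso_mapEdgeSet_apartmentEnum_zero_one_eq hd A hA0 hA1 e).choose,
    fun e => (exists_latticeGraphIso_mapEdgeSet_apartmentEnum_zero_one_eq hd A hA0 hA1 e).choose_spec⟩

end Enum

end Literature.NumberTheory.Automorphic.UnitaryLatticeTree

end
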